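import Mathlib.Analysis.Real.Pi.Bounds
import Literature.Probability.RandomPlanarGeometry.DiscPaths
import Literature.Probability.RandomPlanarGeometry.BoundaryCycle
import Literature.Probability.RandomPlanarGeometry.PolygonStarShaped
import HarnessLib

/-!
# The boundary cycle of the disc approximation `D^m`: simple, and winding around `0`

For the data `(alphaPath m, betaPath m, aIdx m, bIdx m)` of `DiscPaths.lean` (the grid
approximation of the disc of radius `m`, [LSW04] §4.3) we verify the hypotheses of the analytic
simplicity criterion `isSimpleClosedPolygon_of_cross_pos_of_le_norm` and of the inside test
`mem_polygonDomain_of_cross_pos` for the boundary cycle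
`discVerts m = boundaryVerts (alphaPath m) (betaPath m) (aIdx m) (bIdx m)`, per cyclic edge via
`boundaryVerts_cyclic'` and per vertex via `forall_getElem_boundaryVerts`:

* coordinates of lattice points as complex numbers (`cross_primalPt`, `four_mul_cross_dualPt`,
  norms and unit steps);
* `cross_pos_discVerts` — every cyclic edge is seen strictly counterclockwise from `0`
  (staircase steps: integer cross products `≥ 1`, resp. `≥ ½` for the dual path; the four
  junctions at `a^m`, `b^m` have cross product `m/4`; the two middle edges `m`, `m + ½`);
* `norm_discVerts_ge` (`≥ m - ½`), `norm_sub_discVerts_le_one`, `length_discVerts = 8m + 3`;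
* `isSimpleClosedPolygon_discVerts` (`m ≥ 12`) and `zero_mem_polygonDomain_discVerts`.
-/

noncomputable section

open Set Complex

namespace Literature.Probability.RandomPlanarGeometry

namespace USTPeano

variable {m : ℕ}

/-! ### Lattice points as complex numbers -/

/-- Cross product of two primal points. [folklore] -/
theorem cross_primalPt (p q : ℤ × ℤ) :
    cross (primalPt p) (primalPt q) = ((p.1 * q.2 - p.2 * q.1 : ℤ) : ℝ) := by
  simp [cross]

/-- `4 ×` the cross product of two dual points, in integers. [folklore] -/
theorem four_mul_cross_dualPt (u v : ℤ × ℤ) :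
    4 * cross (dualPt u) (dualPt v) =
      (((2 * u.1 + 1) * (2 * v.2 + 1) - (2 * u.2 + 1) * (2 * v.1 + 1) : ℤ) : ℝ) := by
  simp [cross]
  ring

/-- Squared norm of a primal point. [folklore] -/
theorem normSq_primalPt (p : ℤ × ℤ) : Complex.normSq (primalPt p) = ((p.1 ^ 2 + p.2 ^ 2 : ℤ) : ℝ) := by
  simp [Complex.normSq_apply, primalPt]
  ring

/-- `4 ×` the squared norm of a dual point, in integers. [folklore] -/
theorem four_mul_normSq_dualPt (u : ℤ × ℤ) :
    4 * Complex.normSq (dualPt u) = (((2 * u.1 + 1) ^ 2 + (2 * u.2 + 1) ^ 2 : ℤ) : ℝ) := by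
  simp [Complex.normSq_apply, dualPt]
  ring

/-- A lower bound on an integer squared norm gives a lower bound on the norm. [folklore] -/
theorem le_norm_of_sq_le_normSq {z : ℂ} {r : ℝ} (hr : 0 ≤ r) (h : r ^ 2 ≤ Complex.normSq z) :
    r ≤ ‖z‖ := by
  rw [← Real.sqrt_sq hr, Complex.norm_def]
  exact Real.sqrt_le_sqrt h

/-- Adjacent dual vertices are at distance `1`. [folklore] -/
theorem dist_dualPt_of_latticeAdj {u v : ℤ × ℤ} (h : LatticeAdj u v) :
    dist (dualPt u) (dualPt v) = 1 := by
  have : dualPt u - dualPt v = primalPt u - primalPt v := by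
    apply Complex.ext <;> simp
  rw [Complex.dist_eq, this, ← Complex.dist_eq]
  exact dist_primalPt_of_latticeAdj h

/-- The connecting half-diagonals have length `√2/4 ≤ 1`: a Peano vertex is within distance `1`
of its primal neighbour … [folklore] -/
theorem norm_peanoPt_sub_primalPt_le (p : ℤ × ℤ) : ‖peanoPt p - primalPt (primalNbr p)‖ ≤ 1 := by
  obtain ⟨h1, h2⟩ := abs_re_peanoPt_sub_primalPt p
  refine (Complex.norm_le_abs_re_add_abs_im _).trans ?_
  rw [h1, h2]; norm_num

/-- … and of its dual neighbour. [folklore] -/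
theorem norm_peanoPt_sub_dualPt_le (p : ℤ × ℤ) : ‖peanoPt p - dualPt (dualNbr p)‖ ≤ 1 := by
  obtain ⟨h1, h2⟩ := abs_re_peanoPt_sub_dualPt p
  refine (Complex.norm_le_abs_re_add_abs_im _).trans ?_
  rw [h1, h2]; norm_num

/-! ### The boundary cycle of `D^m` -/

/-- The boundary vertex cycle of the disc approximation `D^m`. [folklore] -/
def discVerts (m : ℕ) : List ℂ := boundaryVerts (alphaPath m) (betaPath m) (aIdx m) (bIdx m)

/-- **`D^m` has `8m + 3` boundary vertices** (`m ≥ 1`). [folklore] -/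
theorem length_discVerts (hm : 1 ≤ m) : (discVerts m).length = 8 * m + 3 := by
  rw [discVerts, length_boundaryVerts, length_alphaPath, length_betaPath hm]
  ring

/-- The marked points in coordinates (with `ℂ`-constructor). [folklore] -/
theorem dualPt_dualNbr_aIdx (m : ℕ) : dualPt (dualNbr (aIdx m)) = ⟨(m : ℝ) - 1 / 2, -(1 / 2)⟩ := by
  rw [dualNbr_aIdx]; apply Complex.ext <;> simp <;> ring

/-- `α_a` in coordinates. [folklore] -/
theorem primalPt_primalNbr_aIdx (m : ℕ) : primalPt (primalNbr (aIdx m)) = ⟨(m : ℝ), 0⟩ := by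
  rw [primalNbr_aIdx]; apply Complex.ext <;> simp

/-- `β_b` in coordinates. [folklore] -/
theorem dualPt_dualNbr_bIdx (m : ℕ) : dualPt (dualNbr (bIdx m)) = ⟨-(m : ℝ) + 1 / 2, -(1 / 2)⟩ := by
  rw [dualNbr_bIdx]; apply Complex.ext
  · simp
  · simp; ring

/-- `α_b` in coordinates. [folklore] -/
theorem primalPt_primalNbr_bIdx (m : ℕ) : primalPt (primalNbr (bIdx m)) = ⟨-(m : ℝ), 0⟩ := by
  rw [primalNbr_bIdx]; apply Complex.ext <;> simp

/-- **Every cyclic edge of `D^m` is seen strictly counterclockwise from the origin** (`m ≥ 3`).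
[folklore] -/
theorem cross_pos_discVerts (hm : 3 ≤ m) (k : ℕ) (hk : k < (discVerts m).length) :
    0 < cross ((discVerts m)[k])
      ((discVerts m)[(k + 1) % (discVerts m).length]'(Nat.mod_lt _ (by simp [discVerts]))) := by
  have hmr : (3 : ℝ) ≤ m := by exact_mod_cast hm
  refine boundaryVerts_cyclic' (R := fun u v ↦ 0 < cross u v) (alphaPath_ne_nil m)
    (betaPath_ne_nil m) ?_ ?_ ?_ ?_ ?_ ?_ k hk
  · -- `a → α_a`
    rw [head_alphaPath (by omega), ← primalNbr_aIdx, peanoPt_aIdx, primalPt_primalNbr_aIdx]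
    simp [cross]; linarith
  · -- along `α`
    refine (isChain_cross_alphaPath (by omega)).imp fun p q h ↦ ?_
    rw [cross_primalPt]; exact_mod_cast h
  · -- `α_b → b`
    rw [getLast_alphaPath (by omega), ← primalNbr_bIdx, primalPt_primalNbr_bIdx, peanoPt_bIdx]
    simp [cross]; linarith
  · -- `b → β_b`
    rw [getLast_betaPath hm, ← dualNbr_bIdx, peanoPt_bIdx, dualPt_dualNbr_bIdx]
    simp [cross]; linarith
  · -- along `β`, backwards
    refine (isChain_bStep_betaPath hm).imp fun u v h ↦ ?_
    have h4 := four_mul_cross_dualPt v u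
    have h2 : (2 : ℝ) ≤ (((2 * v.1 + 1) * (2 * u.2 + 1) - (2 * v.2 + 1) * (2 * u.1 + 1) : ℤ) : ℝ) := by
      exact_mod_cast h.2
    linarith
  · -- `β_a → a`
    rw [head_betaPath (by omega), ← dualNbr_aIdx, dualPt_dualNbr_aIdx, peanoPt_aIdx]
    simp [cross]; linarith

/-- **Every vertex of `D^m` is at distance `≥ m - ½` from the origin** (`m ≥ 1`). [folklore] -/
theorem norm_discVerts_ge (hm : 1 ≤ m) (k : ℕ) (hk : k < (discVerts m).length) :
    (m : ℝ) - 1 / 2 ≤ ‖(discVerts m)[k] - 0‖ := by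
  rw [sub_zero]
  have hmr : (1 : ℝ) ≤ m := by exact_mod_cast hm
  refine forall_getElem_boundaryVerts (Q := fun v ↦ (m : ℝ) - 1 / 2 ≤ ‖v‖) ?_ ?_ ?_ ?_ k hk
  · rw [peanoPt_aIdx]
    refine le_norm_of_sq_le_normSq (by linarith) ?_
    simp [Complex.normSq_apply]; nlinarith
  · rw [peanoPt_bIdx]
    refine le_norm_of_sq_le_normSq (by linarith) ?_
    simp [Complex.normSq_apply]; nlinarith
  · intro v hv
    have hb := mem_alphaPath_bounds hv
    refine le_norm_of_sq_le_normSq (by linarith) ?_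
    rw [normSq_primalPt]
    have : ((m : ℤ) : ℝ) ^ 2 ≤ ((v.1 ^ 2 + v.2 ^ 2 : ℤ) : ℝ) := by exact_mod_cast hb.2.2.2.2.1
    push_cast at this ⊢
    nlinarith
  · intro v hv
    have hb := mem_betaPath_bounds hm hv
    refine le_norm_of_sq_le_normSq (by linarith) ?_
    have h4 := four_mul_normSq_dualPt v
    have : ((4 * (m : ℤ) ^ 2 - 4 * m + 2 : ℤ) : ℝ) ≤ (((2 * v.1 + 1) ^ 2 + (2 * v.2 + 1) ^ 2 : ℤ) : ℝ) := by
      exact_mod_cast hb.2.2.2.2.1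
    push_cast at this h4
    nlinarith

/-- **Every vertex of `D^m` is at distance `≤ m + 3` from the origin** (`m ≥ 1`). [folklore] -/
theorem norm_discVerts_le (hm : 1 ≤ m) (k : ℕ) (hk : k < (discVerts m).length) :
    ‖(discVerts m)[k]‖ ≤ (m : ℝ) + 3 := by
  have hmr : (1 : ℝ) ≤ m := by exact_mod_cast hm
  have key : ∀ z : ℂ, Complex.normSq z ≤ ((m : ℝ) + 3) ^ 2 → ‖z‖ ≤ (m : ℝ) + 3 := fun z hz ↦ by
    rw [Complex.norm_def, ← Real.sqrt_sq (by linarith : (0 : ℝ) ≤ m + 3)]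
    exact Real.sqrt_le_sqrt hz
  refine forall_getElem_boundaryVerts (Q := fun v ↦ ‖v‖ ≤ (m : ℝ) + 3) ?_ ?_ ?_ ?_ k hk
  · rw [peanoPt_aIdx]; apply key; simp [Complex.normSq_apply]; nlinarith
  · rw [peanoPt_bIdx]; apply key; simp [Complex.normSq_apply]; nlinarith
  · intro v hv
    have hb := mem_alphaPath_bounds hv
    apply key
    rw [normSq_primalPt]
    have : ((v.1 ^ 2 + v.2 ^ 2 : ℤ) : ℝ) < (((m : ℤ) + 2) ^ 2 : ℤ) := by exact_mod_cast hb.2.2.2.2.2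
    push_cast at this ⊢
    nlinarith
  · intro v hv
    have hb := mem_betaPath_bounds hm hv
    apply key
    have h4 := four_mul_normSq_dualPt v
    have : (((2 * v.1 + 1) ^ 2 + (2 * v.2 + 1) ^ 2 : ℤ) : ℝ) < ((4 * ((m : ℤ) + 3) ^ 2 : ℤ) : ℝ) := by
      exact_mod_cast hb.2.2.2.2.2
    push_cast at this h4
    nlinarith

/-- **Consecutive vertices of `D^m` are at distance `≤ 1`** (`m ≥ 3`). [folklore] -/
theorem norm_sub_discVerts_le_one (hm : 3 ≤ m) (k : ℕ) (hk : k < (discVerts m).length) :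
    ‖(discVerts m)[(k + 1) % (discVerts m).length]'(Nat.mod_lt _ (by simp [discVerts])) -
      (discVerts m)[k]‖ ≤ 1 := by
  refine boundaryVerts_cyclic' (R := fun u v ↦ ‖v - u‖ ≤ 1) (alphaPath_ne_nil m)
    (betaPath_ne_nil m) ?_ ?_ ?_ ?_ ?_ ?_ k hk
  · rw [head_alphaPath (by omega), ← primalNbr_aIdx, ← norm_neg, neg_sub]
    exact norm_peanoPt_sub_primalPt_le _
  · refine (isChain_latticeAdj_alphaPath (by omega)).imp fun p q h ↦ ?_
    rw [← dist_eq_norm, dist_comm, dist_primalPt_of_latticeAdj h]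
  · rw [getLast_alphaPath (by omega), ← primalNbr_bIdx]
    exact norm_peanoPt_sub_primalPt_le _
  · rw [getLast_betaPath hm, ← dualNbr_bIdx, ← norm_neg, neg_sub]
    exact norm_peanoPt_sub_dualPt_le _
  · refine (isChain_latticeAdj_betaPath hm).imp fun u v h ↦ ?_
    rw [← dist_eq_norm, dist_dualPt_of_latticeAdj h]
  · rw [head_betaPath (by omega), ← dualNbr_aIdx]
    exact norm_peanoPt_sub_dualPt_le _

/-- **The boundary polygon of `D^m` is simple** (`m ≥ 12`; `8m + 3 < 4π (m - 3/2)`). [folklore] -/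
theorem isSimpleClosedPolygon_discVerts (hm : 12 ≤ m) : IsSimpleClosedPolygon (discVerts m) := by
  have hl : 0 < (discVerts m).length := by simp [discVerts]
  have hmr : (12 : ℝ) ≤ m := by exact_mod_cast hm
  refine isSimpleClosedPolygon_of_cross_pos_of_le_norm (z := 0) (r := (m : ℝ) - 1 / 2) hl
    (by linarith) (norm_discVerts_ge (by omega)) ?_ ?_ ?_
  · intro k hk
    simpa using norm_sub_discVerts_le_one (by omega) k hk
  · intro k hk
    simpa using cross_pos_discVerts (by omega) k hk
  · rw [length_discVerts (by omega)]
    push_cast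
    nlinarith [Real.pi_gt_three]

/-- **The origin lies inside `D^m`** (`m ≥ 12`). [folklore] -/
theorem zero_mem_polygonDomain_discVerts (hm : 12 ≤ m) :
    (0 : ℂ) ∈ (polygonDomain (discVerts m) (isSimpleClosedPolygon_discVerts hm)).carrier :=
  mem_polygonDomain_of_cross_pos _ fun k hk ↦ by simpa using cross_pos_discVerts (by omega) k hk

end USTPeano

end Literature.Probability.RandomPlanarGeometry
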